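import Summits.Ventures.PercRepro.LawForm

/-!
# PercRepro — C-024 «CLASS-vdBHK»: every vdBHK06 placement on four marks at the class level (typer-2, gen 6)

`conjectures/CONJECTURES.md` row C-024 (mine-4 (g4) «CLASS-vdBHK», adversary-found, 10:26:04Z / 10:48:37Z /
10:51:08Z; C-id by the lead 10:52:19Z; census: every class of every multigraph with ≤ 7 vertices × 5,609 kernels,
0 negatives, three class engines agreeing). The FAMILY is the one of the generators of record
`data/mine-4/g4/tools/gen_k7.py` (van den Berg–Häggström–Kahn 2006 Theorem 2.1 placements) and `gen_k5.py`
(Theorem 1.1 placements), typed 1-1: nothing is enumerated here — the placement data are quantified and the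
kernels are defined by the generators' formulas.

* A **Theorem 2.1 placement** is a pair of disjoint nonempty sets of marks `S, T ⊆ {a, b, c, d}` and two Boolean
  functions `f, g` of the rows that are MONOTONE Boolean functions of the joint literal vector — the increasing
  literals `s ~ s′`, `s ~ u` (`s, s′ ∈ S`, `u ∉ S ∪ T`) and the decreasing ones `t ≁ t′`, `t ≁ u` (`t, t′ ∈ T`) —,
  `Q = {S ↮ T}`, and the symmetrised antipodal kernel `K(s, t) = F(s) Q(t) + F(t) Q(s) − fQ(s) gQ(t) − fQ(t) gQ(s)`
  with `F = f g Q` (`kernel21`; the diagonal vanishes).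
* A **Theorem 1.1 placement** is a mark `s`, two monotone Boolean functions `A, B` of the literals `s ~ u` (`u ≠ s`),
  two sets `X, Y ⊆ marks ∖ {s}` (possibly empty), `R_X = {s ↮ X}`, and the kernel
  `K(p, q) = AB R_{X∩Y}(p) R_{X∪Y}(q) + (p ↔ q) − A R_X(p) B R_Y(q) − (p ↔ q)` (`kernel11`).

**C-024** says that every such kernel is CLASS-NONNEGATIVE: on every face `[v, u]` of the edge cube of every
finite multigraph with marks `a, b, c, d` the antipodal sum `Σ_ρ K(row ρ, row ρᶜ)` is `≥ 0` (`ClassNonneg` — the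
hypothesis of `lawForm_nonneg_of_faces`, ordered antipodal pairs). The law-level consequences are the printed
theorems: `lawForm_kernel21` / `lawForm_kernel11` identify the law forms as twice the two-copy slacks
`E[fgQ] E[Q] − E[fQ] E[gQ]` resp. `E[AB R_{X∩Y}] E[R_{X∪Y}] − E[A R_X] E[B R_Y]` on the law `π = law4`
(`lawForm_nonneg_of_classNonneg` gives them from the class level at every `p ∈ [0,1]^E`).

Anchors: `rowConn_row4_markedPartition` (the literal `i ~ j` of the row of the marked partition IS the connection
of the marks in `ω`), `sepRows_row4_markedPartition` (`Q` is the event `S ↮ T`). Sanity tables decided from the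
formulas: `INST_ab` (= `+1·{4,13} − 1·{3,14}`), `V2` and `V3 = C-002` of the candidate note — `V3` has the nine
entries `+{2,9} +{2,13} +{4,9} +{4,13} −{3,8} −{3,10} −{3,11} −{3,12} −{3,14}` (the generator's file
`k57_kernels.txt.gz` agrees; the candidate note's hand list omits `−{3,12}`).
-/

namespace PercRepro

open Finset

/-! ### Literals on the rows -/

/-- The literal `i ~ j` read on the engine row `s` (`rgs4`): the marks `i` and `j` are in the same block. -/
def rowConn (s : Fin 15) (i j : Fin 4) : Bool := decide (rgs4 s i = rgs4 s j)

/-- `rowConn` is symmetric. -/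
theorem rowConn_comm (s : Fin 15) (i j : Fin 4) : rowConn s i j = rowConn s j i :=
  decide_eq_decide.mpr eq_comm

open Classical in
/-- **The literal of the row of the marked partition is the connection of the marks**: on `row4 Π(ω)` the
literal `i ~ j` reads `m i ↔ m j` in `ω`. -/
theorem MultiGraph.rowConn_row4_markedPartition {V E : Type*} (G : MultiGraph V E) (ω : Config E)
    (m : Fin 4 → V) (i j : Fin 4) :
    rowConn (row4 (G.markedPartition ω m)) i j = decide (G.Conn ω (m i) (m j)) := by
  have h := (G.row4_markedPartition_eq_iff (ω := ω) m (row4 (G.markedPartition ω m))).1 rfl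
  simp only [MultiGraph.partitionEvent, Set.mem_setOf_eq] at h
  exact decide_eq_decide.mpr (h i j).symm

/-! ### Theorem 2.1 placements -/

/-- The increasing literals of the placement `(S, T)`: `(i, j)` with `i ∈ S`, `j ≠ i`, `j ∉ T` — the literals
`s ~ s′` (`s, s′ ∈ S`, both orientations) and `s ~ u` (`u ∉ S ∪ T`); `gen_k7.py`'s `flits` up to the orientation
duplicates, which change nothing (`rowConn_comm`). -/
def fLits21 (S T : Finset (Fin 4)) (ij : Fin 4 × Fin 4) : Prop := ij.1 ∈ S ∧ ij.2 ≠ ij.1 ∧ ij.2 ∉ T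

/-- The decreasing literals of the placement `(S, T)`: `(i, j)` with `i ∈ T`, `j ≠ i`, `j ∉ S` — the literals
`t ≁ t′` (`t, t′ ∈ T`) and `t ≁ u` (`u ∉ S ∪ T`); `gen_k7.py`'s `glits`. -/
def gLits21 (S T : Finset (Fin 4)) (ij : Fin 4 × Fin 4) : Prop := ij.1 ∈ T ∧ ij.2 ≠ ij.1 ∧ ij.2 ∉ S

/-- `fLits21 S T` is a decidable predicate (unfold and decide). -/
instance (S T : Finset (Fin 4)) : DecidablePred (fLits21 S T) := fun _ => by
  unfold fLits21; infer_instance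

/-- `gLits21 S T` is a decidable predicate (unfold and decide). -/
instance (S T : Finset (Fin 4)) : DecidablePred (gLits21 S T) := fun _ => by
  unfold gLits21; infer_instance

/-- The joint literal vector of the row `s` for the placement `(S, T)`: `[i ~ j]` on the increasing literals,
`[i ≁ j]` on the decreasing ones, `false` elsewhere (the generator's `(conn(flits), 1 − conn(glits))`). -/
def litVec21 (S T : Finset (Fin 4)) (s : Fin 15) (ij : Fin 4 × Fin 4) : Bool :=
  if fLits21 S T ij then rowConn s ij.1 ij.2 else if gLits21 S T ij then !rowConn s ij.1 ij.2 else false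

/-- **`f` is a monotone Boolean function of the joint literal vector of `(S, T)`** (increasing in `C_S`,
decreasing in `C_T`): `f = φ ∘ litVec21 S T` for a monotone `φ` (product order on the vectors; the generator
enumerates all monotone truth tables of the literal list — the same class of functions `f`). -/
def IsMonoLit21 (S T : Finset (Fin 4)) (f : Fin 15 → Bool) : Prop :=
  ∃ φ : (Fin 4 × Fin 4 → Bool) → Bool, Monotone φ ∧ ∀ s, f s = φ (litVec21 S T s)

/-- `Q = {S ↮ T}` on the rows: no `i ∈ S` shares a block with a `j ∈ T`. -/
def sepRows (S T : Finset (Fin 4)) (s : Fin 15) : Bool :=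
  decide (∀ i ∈ S, ∀ j ∈ T, rowConn s i j = false)

/-- The `0 / 1` value of a Boolean. -/
def bInd (b : Bool) : ℤ := if b then 1 else 0

/-- **The symmetrised antipodal kernel of the Theorem 2.1 placement `(S, T, f, g)`**:
`K(s, t) = F(s) Q(t) + F(t) Q(s) − fQ(s) gQ(t) − fQ(t) gQ(s)`, `F = f g Q` (`gen_k7.py`). -/
def kernel21 (S T : Finset (Fin 4)) (f g : Fin 15 → Bool) (s t : Fin 15) : ℤ :=
  bInd (f s) * bInd (g s) * bInd (sepRows S T s) * bInd (sepRows S T t) +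
    bInd (f t) * bInd (g t) * bInd (sepRows S T t) * bInd (sepRows S T s) -
    bInd (f s) * bInd (sepRows S T s) * (bInd (g t) * bInd (sepRows S T t)) -
    bInd (f t) * bInd (sepRows S T t) * (bInd (g s) * bInd (sepRows S T s))

/-! ### Theorem 1.1 placements -/

/-- The literals `s ~ u`, `u ≠ s`, of a Theorem 1.1 placement at the mark `s` (`gen_k5.py`'s `lits`). -/
def starLits11 (s : Fin 4) (ij : Fin 4 × Fin 4) : Prop := ij.1 = s ∧ ij.2 ≠ s

/-- `starLits11 s` is a decidable predicate (unfold and decide). -/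
instance (s : Fin 4) : DecidablePred (starLits11 s) := fun _ => by
  unfold starLits11; infer_instance

/-- The literal vector `[s ~ u]_{u ≠ s}` of the row `p` (`false` off the star). -/
def starVec11 (s : Fin 4) (p : Fin 15) (ij : Fin 4 × Fin 4) : Bool :=
  if starLits11 s ij then rowConn p ij.1 ij.2 else false

/-- **`A` is a monotone Boolean function of the literals `s ~ u`, `u ≠ s`** (an increasing event determined by
the cluster of `s` on the marks). -/
def IsMonoStar11 (s : Fin 4) (A : Fin 15 → Bool) : Prop :=
  ∃ φ : (Fin 4 × Fin 4 → Bool) → Bool, Monotone φ ∧ ∀ p, A p = φ (starVec11 s p)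

/-- `R_X = {s ↮ X}` on the rows: `s` shares no block with a mark of `X` (`R_∅ = true`). -/
def sepFromRows (s : Fin 4) (X : Finset (Fin 4)) (p : Fin 15) : Bool :=
  decide (∀ u ∈ X, rowConn p s u = false)

/-- **The symmetrised antipodal kernel of the Theorem 1.1 placement `(s, A, B, X, Y)`**:
`K(p, q) = AB R_{X∩Y}(p) R_{X∪Y}(q) + AB R_{X∩Y}(q) R_{X∪Y}(p) − A R_X(p) B R_Y(q) − A R_X(q) B R_Y(p)`
(`gen_k5.py`). -/
def kernel11 (s : Fin 4) (A B : Fin 15 → Bool) (X Y : Finset (Fin 4)) (p q : Fin 15) : ℤ :=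
  bInd (A p) * bInd (B p) * bInd (sepFromRows s (X ∩ Y) p) * bInd (sepFromRows s (X ∪ Y) q) +
    bInd (A q) * bInd (B q) * bInd (sepFromRows s (X ∩ Y) q) * bInd (sepFromRows s (X ∪ Y) p) -
    bInd (A p) * bInd (sepFromRows s X p) * (bInd (B q) * bInd (sepFromRows s Y q)) -
    bInd (A q) * bInd (sepFromRows s X q) * (bInd (B p) * bInd (sepFromRows s Y p))

/-! ### The class level -/

/-- **Class-nonnegativity of a row kernel**: on every face `[v, u]` of the edge cube of every marked finite
multigraph the antipodal sum `Σ_ρ K(row(embed ρ), row(embed ρᶜ))` is `≥ 0` — ordered antipodal pairs, exactly the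
hypothesis of `lawForm_nonneg_of_faces` (for a symmetric kernel this is twice the unordered class sum the
censuses evaluate). -/
def ClassNonneg (K : Fin 15 → Fin 15 → ℝ) : Prop :=
  ∀ {V E : Type} [Fintype E] [DecidableEq E] (G : MultiGraph V E) (a b c d : V)
    (u v : Config E), v ≤ u →
      0 ≤ ∑ ρ : Config (Face u v),
        K (row4 (G.markedPartition (embed u v ρ) ![a, b, c, d]))
          (row4 (G.markedPartition (embed u v ρᶜ) ![a, b, c, d]))

/-- **C-024, the Theorem 2.1 half**: every placement `(S, T, f, g)` — `S, T` disjoint nonempty, `f, g` monotone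
in the joint literal vector — has a class-nonnegative kernel. -/
def C024Thm21 : Prop :=
  ∀ (S T : Finset (Fin 4)), S.Nonempty → T.Nonempty → Disjoint S T →
    ∀ f g : Fin 15 → Bool, IsMonoLit21 S T f → IsMonoLit21 S T g →
      ClassNonneg fun s t => (kernel21 S T f g s t : ℝ)

/-- **C-024, the Theorem 1.1 half**: every placement `(s, A, B, X, Y)` — `A, B` monotone in the literals
`s ~ u`, `X, Y ⊆ marks ∖ {s}` — has a class-nonnegative kernel. -/
def C024Thm11 : Prop :=
  ∀ (s : Fin 4) (A B : Fin 15 → Bool), IsMonoStar11 s A → IsMonoStar11 s B →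
    ∀ X Y : Finset (Fin 4), s ∉ X → s ∉ Y →
      ClassNonneg fun p q => (kernel11 s A B X Y p q : ℝ)

/-- **C-024 = CLASS-vdBHK** (`conjectures/CONJECTURES.md`, mine-4 (g4), C-id lead 10:52:19Z): every placement of
vdBHK06 Theorem 2.1 and of Theorem 1.1 on four marks is class-nonnegative on every class of every finite
multigraph. -/
def C024 : Prop := C024Thm21 ∧ C024Thm11

/-! ### Admissible `f`, `g`: the single literals -/

/-- A single increasing literal of the placement is admissible. -/
theorem isMonoLit21_conn {S T : Finset (Fin 4)} {i j : Fin 4} (h : fLits21 S T (i, j)) :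
    IsMonoLit21 S T fun s => rowConn s i j :=
  ⟨fun x => x (i, j), fun _ _ hxy => hxy (i, j), fun s => by simp [litVec21, h]⟩

/-- A single decreasing literal of the placement is admissible (`S`, `T` disjoint). -/
theorem isMonoLit21_not_conn {S T : Finset (Fin 4)} (hST : Disjoint S T) {i j : Fin 4}
    (h : gLits21 S T (i, j)) : IsMonoLit21 S T fun s => !rowConn s i j := by
  have hf : ¬ fLits21 S T (i, j) := fun hf => Finset.disjoint_left.1 hST hf.1 h.1
  exact ⟨fun x => x (i, j), fun _ _ hxy => hxy (i, j), fun s => by simp [litVec21, h, hf]⟩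

/-- A single literal `s ~ u` is admissible for the Theorem 1.1 placement at `s`. -/
theorem isMonoStar11_conn {s u : Fin 4} (h : u ≠ s) : IsMonoStar11 s fun p => rowConn p s u :=
  ⟨fun x => x (s, u), fun _ _ hxy => hxy (s, u), fun p => by simp [starVec11, starLits11, h]⟩

/-! ### Anchors: the rows read the events -/

namespace MultiGraph

variable {V E : Type*} (G : MultiGraph V E)

open Classical in
/-- **`Q` on the row of the marked partition is the event `S ↮ T`.** -/
theorem sepRows_row4_markedPartition (ω : Config E) (m : Fin 4 → V) (S T : Finset (Fin 4)) :
    sepRows S T (row4 (G.markedPartition ω m)) =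
      decide (∀ i ∈ S, ∀ j ∈ T, ¬ G.Conn ω (m i) (m j)) := by
  unfold sepRows
  simp only [rowConn_row4_markedPartition, decide_eq_false_iff_not]

open Classical in
/-- **`R_X` on the row of the marked partition is the event `s ↮ X`.** -/
theorem sepFromRows_row4_markedPartition (ω : Config E) (m : Fin 4 → V) (s : Fin 4)
    (X : Finset (Fin 4)) :
    sepFromRows s X (row4 (G.markedPartition ω m)) = decide (∀ u ∈ X, ¬ G.Conn ω (m s) (m u)) := by
  unfold sepFromRows
  simp only [rowConn_row4_markedPartition, decide_eq_false_iff_not]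

end MultiGraph

/-! ### The law level -/

/-- **Class-nonnegativity gives the law form at every `p`** (`lawForm_nonneg_of_faces`). -/
theorem MultiGraph.lawForm_nonneg_of_classNonneg {V E : Type} [Fintype E] [DecidableEq E]
    (G : MultiGraph V E) {K : Fin 15 → Fin 15 → ℝ} (hK : ClassNonneg K) {p : E → ℝ}
    (hp : IsProb p) (a b c d : V) :
    0 ≤ ∑ s : Fin 15, ∑ t : Fin 15, K s t * (G.law4 p a b c d s * G.law4 p a b c d t) :=
  G.lawForm_nonneg_of_faces K hp a b c d fun u v huv => hK G a b c d u v huv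

/-- Two single sums against `π` multiply into the double sum. -/
theorem sum_mul_sum_pi (π x y : Fin 15 → ℝ) :
    (∑ s, x s * π s) * (∑ t, y t * π t) = ∑ s, ∑ t, x s * y t * (π s * π t) := by
  rw [Finset.sum_mul_sum]
  exact Finset.sum_congr rfl fun s _ => Finset.sum_congr rfl fun t _ => by ring

/-- The swapped double sum is the double sum. -/
theorem sum_sum_swap_pi (π x y : Fin 15 → ℝ) :
    ∑ s, ∑ t, x t * y s * (π s * π t) = ∑ s, ∑ t, x s * y t * (π s * π t) := by
  rw [Finset.sum_comm]
  exact Finset.sum_congr rfl fun s _ => Finset.sum_congr rfl fun t _ => by ring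

/-- **The law form of a Theorem 2.1 kernel is twice `E[fgQ] E[Q] − E[fQ] E[gQ]`** on any law `π`
(the printed Theorem 2.1, `q = 1`: `E[fg | Q] ≥ E[f | Q] E[g | Q]`, after dividing by `E[Q]²`). -/
theorem lawForm_kernel21 (S T : Finset (Fin 4)) (f g : Fin 15 → Bool) (π : Fin 15 → ℝ) :
    ∑ s : Fin 15, ∑ t : Fin 15, (kernel21 S T f g s t : ℝ) * (π s * π t) =
      2 * ((∑ s, ((bInd (f s) * bInd (g s) * bInd (sepRows S T s) : ℤ) : ℝ) * π s) *
            (∑ t, ((bInd (sepRows S T t) : ℤ) : ℝ) * π t) -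
          (∑ s, ((bInd (f s) * bInd (sepRows S T s) : ℤ) : ℝ) * π s) *
            (∑ t, ((bInd (g t) * bInd (sepRows S T t) : ℤ) : ℝ) * π t)) := by
  set F : Fin 15 → ℝ := fun s => ((bInd (f s) * bInd (g s) * bInd (sepRows S T s) : ℤ) : ℝ) with hF
  set Q : Fin 15 → ℝ := fun s => ((bInd (sepRows S T s) : ℤ) : ℝ) with hQ
  set fQ : Fin 15 → ℝ := fun s => ((bInd (f s) * bInd (sepRows S T s) : ℤ) : ℝ) with hfQ
  set gQ : Fin 15 → ℝ := fun s => ((bInd (g s) * bInd (sepRows S T s) : ℤ) : ℝ) with hgQ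
  have hterm : ∀ s t, (kernel21 S T f g s t : ℝ) * (π s * π t) =
      F s * Q t * (π s * π t) + F t * Q s * (π s * π t) - fQ s * gQ t * (π s * π t) -
        fQ t * gQ s * (π s * π t) := by
    intro s t
    simp only [kernel21, hF, hQ, hfQ, hgQ]
    push_cast
    ring
  simp only [hterm, Finset.sum_add_distrib, Finset.sum_sub_distrib]
  rw [sum_sum_swap_pi π F Q, sum_sum_swap_pi π fQ gQ, sum_mul_sum_pi π F Q, sum_mul_sum_pi π fQ gQ]
  ring

/-- **The law form of a Theorem 1.1 kernel is twice `E[AB R_{X∩Y}] E[R_{X∪Y}] − E[A R_X] E[B R_Y]`** on any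
law `π` (the printed Theorem 1.1: `Pr(A R_X) Pr(B R_Y) ≤ Pr(AB R_{X∩Y}) Pr(R_{X∪Y})`). -/
theorem lawForm_kernel11 (s : Fin 4) (A B : Fin 15 → Bool) (X Y : Finset (Fin 4)) (π : Fin 15 → ℝ) :
    ∑ p : Fin 15, ∑ q : Fin 15, (kernel11 s A B X Y p q : ℝ) * (π p * π q) =
      2 * ((∑ p, ((bInd (A p) * bInd (B p) * bInd (sepFromRows s (X ∩ Y) p) : ℤ) : ℝ) * π p) *
            (∑ q, ((bInd (sepFromRows s (X ∪ Y) q) : ℤ) : ℝ) * π q) -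
          (∑ p, ((bInd (A p) * bInd (sepFromRows s X p) : ℤ) : ℝ) * π p) *
            (∑ q, ((bInd (B q) * bInd (sepFromRows s Y q) : ℤ) : ℝ) * π q)) := by
  set F : Fin 15 → ℝ := fun p => ((bInd (A p) * bInd (B p) * bInd (sepFromRows s (X ∩ Y) p) : ℤ) : ℝ)
    with hF
  set RU : Fin 15 → ℝ := fun q => ((bInd (sepFromRows s (X ∪ Y) q) : ℤ) : ℝ) with hRU
  set AX : Fin 15 → ℝ := fun p => ((bInd (A p) * bInd (sepFromRows s X p) : ℤ) : ℝ) with hAX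
  set BY : Fin 15 → ℝ := fun q => ((bInd (B q) * bInd (sepFromRows s Y q) : ℤ) : ℝ) with hBY
  have hterm : ∀ p q, (kernel11 s A B X Y p q : ℝ) * (π p * π q) =
      F p * RU q * (π p * π q) + F q * RU p * (π p * π q) - AX p * BY q * (π p * π q) -
        AX q * BY p * (π p * π q) := by
    intro p q
    simp only [kernel11, hF, hRU, hAX, hBY]
    push_cast
    ring
  simp only [hterm, Finset.sum_add_distrib, Finset.sum_sub_distrib]
  rw [sum_sum_swap_pi π F RU, sum_sum_swap_pi π AX BY, sum_mul_sum_pi π F RU, sum_mul_sum_pi π AX BY]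
  ring

/-! ### Sanity tables (decided from the formulas) -/

/-- The kernel `+1·{4,13} − 1·{3,14}` (`INST_ab` of the candidate note; rows `4 = ab|c|d`, `13 = a|b|cd`,
`3 = ab|cd`, `14 = ⊥`), symmetric. -/
def instAB (s t : Fin 15) : ℤ :=
  if (s = 4 ∧ t = 13) ∨ (s = 13 ∧ t = 4) then 1
  else if (s = 3 ∧ t = 14) ∨ (s = 14 ∧ t = 3) then -1 else 0

set_option maxRecDepth 8000 in
/-- **`INST_ab`**: `S = ab`, `T = cd`, `f = [a ~ b]`, `g = [c ≁ d]` gives `+1·{4,13} − 1·{3,14}`. -/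
theorem kernel21_inst_ab :
    ∀ s t : Fin 15,
      kernel21 {0, 1} {2, 3} (fun s => rowConn s 0 1) (fun s => !rowConn s 2 3) s t = instAB s t := by
  decide

/-- The kernel `+{4,13} +{4,9} −{3,14} −{3,10} −{3,12}` (`V2` of the candidate note), symmetric. -/
def kernelV2 (s t : Fin 15) : ℤ :=
  if (s = 4 ∧ t = 13) ∨ (s = 13 ∧ t = 4) ∨ (s = 4 ∧ t = 9) ∨ (s = 9 ∧ t = 4) then 1
  else if (s = 3 ∧ t = 14) ∨ (s = 14 ∧ t = 3) ∨ (s = 3 ∧ t = 10) ∨ (s = 10 ∧ t = 3) ∨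
      (s = 3 ∧ t = 12) ∨ (s = 12 ∧ t = 3) then -1 else 0

set_option maxRecDepth 8000 in
/-- **`V2`**: `S = a`, `T = cd`, `f = [a ~ b]`, `g = [c ≁ d]` gives `+{4,13} +{4,9} −{3,14} −{3,10} −{3,12}`. -/
theorem kernel21_V2 :
    ∀ s t : Fin 15,
      kernel21 {0} {2, 3} (fun s => rowConn s 0 1) (fun s => !rowConn s 2 3) s t = kernelV2 s t := by
  decide

/-- The kernel `+{2,9} +{2,13} +{4,9} +{4,13} −{3,8} −{3,10} −{3,11} −{3,12} −{3,14}` (`V3 = C-002 =`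
vdBHK Theorem 1.4 placement `S = a`, `T = c`, `f = [a ~ b]`, `g = [c ≁ d]`), symmetric. -/
def kernelV3 (s t : Fin 15) : ℤ :=
  if (s = 2 ∧ t = 9) ∨ (s = 9 ∧ t = 2) ∨ (s = 2 ∧ t = 13) ∨ (s = 13 ∧ t = 2) ∨
      (s = 4 ∧ t = 9) ∨ (s = 9 ∧ t = 4) ∨ (s = 4 ∧ t = 13) ∨ (s = 13 ∧ t = 4) then 1
  else if (s = 3 ∧ t = 8) ∨ (s = 8 ∧ t = 3) ∨ (s = 3 ∧ t = 10) ∨ (s = 10 ∧ t = 3) ∨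
      (s = 3 ∧ t = 11) ∨ (s = 11 ∧ t = 3) ∨ (s = 3 ∧ t = 12) ∨ (s = 12 ∧ t = 3) ∨
      (s = 3 ∧ t = 14) ∨ (s = 14 ∧ t = 3) then -1 else 0

set_option maxRecDepth 8000 in
/-- **`V3 = C-002`**: `S = a`, `T = c`, `f = [a ~ b]`, `g = [c ≁ d]` gives the nine-entry kernel `kernelV3`
(`k57_kernels.txt.gz` line `S=a T=c f#19 g#28`; the candidate note's list omits `−{3,12}`). -/
theorem kernel21_V3 :
    ∀ s t : Fin 15,
      kernel21 {0} {2} (fun s => rowConn s 0 1) (fun s => !rowConn s 2 3) s t = kernelV3 s t := by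
  decide

/-- The three placements above are admissible: `f = [a ~ b]`, `g = [c ≁ d]` are single literals of each. -/
theorem inst_ab_admissible :
    IsMonoLit21 {0, 1} {2, 3} (fun s => rowConn s 0 1) ∧
      IsMonoLit21 {0, 1} {2, 3} (fun s => !rowConn s 2 3) :=
  ⟨isMonoLit21_conn (by decide), isMonoLit21_not_conn (by decide) (by decide)⟩

end PercRepro
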